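import Mathlib
import Literature.MathematicalPhysics.StatisticalMechanics.Yuhjtman2015Theta
import HarnessLib

/-!
# Minimal distance `7/10` in Lennard-Jones ground states — DEFINITIONS (stub `stub_minDistance07` of line `Sketch`, crux `LjLaminarWindows`, stmt-AtomisticToContinuum-6711)

Support file (definitions, plus the one-line-of-attack proof of the final numerical inequality
`stub_forceFinalIneq`; all other proofs live in the sibling files
`ChessboardParticlePlanesLjLaminarWindowsMinDistForce*.lean`) for the proof that every
Lennard-Jones ground state in `ℝ³` has all interparticle distances `≥ 7/10`, sharpening
Yuhjtman's `0.684` (`Yuhjtman2015_minDistance_holds`).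

The sharpening (lead prover-line-stmt-AtomisticToContinuum-6711-c1-0, 2026-08-16).  At a closest
pair `(p, q)` of a ground state, distance `a`, with `h = hLJ` Yuhjtman's minus-energy
(`h = -12 V_LJ`, `h' = hLJ'` below):

* removal + insertion next to an extreme particle: `∑_{k ≠ p} h(r_{pk}) ≥ 1`;
* FORCE BALANCE (the ground state is a critical point of the energy in `x_p`):
  `∑_{k ≠ p} h'(r_{pk}) û_k = 0`; dotted with `û_q` and weighted by `t = 1/25` this gives
  `∑_{k ≠ p, q} (h(r_{pk}) + t |h'(r_{pk})|) ≥ 1 - h(a) + t h'(a)` (`= 99.96` at `a = 0.7`,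
  against `56.2` without the force term);
* a Yuhjtman-type capacity bound for the CHARGED minus-energy `kF = h + t|h'|`:
  `∑ kF(‖z_i‖) ≤ 3 J̄ / c³` over `2c`-separated points of norm `≥ 2c` (`c = a/2`), with the
  radial majorant `thetaF` (the line `AF/v - BF` on `(0, 3/2]`, `kF` beyond; `v thetaF(v) = gamF` is
  convex), the truncation `thetaFcut m` at `m = 0.64`, and `J̄ = 28/25 ≥ ∫_{0.64}^∞ v² thetaF`;
* the final inequality `24 J̄ / a³ < 1 - h(a) + t h'(a)` on `[0.684, 0.7]` (margin `21 %`).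

All constants are rational (`t = 1/25`, junction `u = 3/2`, slope `BF = 37/20`,
`AF = gamF(3/2⁺) + BF·3/2 = 7240007/2361960`, cut-off `m = 16/25`, `J̄ = 28/25`); every auxiliary
one-variable inequality is a polynomial inequality with positive Bernstein coefficients (lead's
numerics `work/numerics/*.py`).  The `Prop`s `ForceThetaFacts`, `ForceClubsuitFacts`,
`ForceCapacity`, `ForceFinalIneq` are the registered stub statements of the skeleton
(`Cruxes/LjLaminarWindows/Lines/Sketch.lean`, rev 5).
-/

noncomputable section

open MeasureTheory intervalIntegral
open Literature.MathematicalPhysics.StatisticalMechanics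
open Literature.MathematicalPhysics.StatisticalMechanics.Yuhjtman2015

namespace Summit.AtomisticToContinuum.Crystallization.Theorems.LjLaminarWindowsSketch

/-- The derivative `h'(v) = 12 v⁻¹³ - 12 v⁻⁷` of Yuhjtman's minus-energy `hLJ v = 2v⁻⁶ - v⁻¹²`
(positive on `(0,1)`, negative on `(1,∞)`). [folklore] -/
def hLJ' (v : ℝ) : ℝ := 12 * v⁻¹ ^ 13 - 12 * v⁻¹ ^ 7

/-- The CHARGED minus-energy `kF(v) = h(v) + (1/25)|h'(v)|`: the quantity whose sum over the
neighbours of the closest-pair particle is bounded below by removal + force balance. [folklore] -/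
def kF (v : ℝ) : ℝ := hLJ v + 1 / 25 * |hLJ' v|

/-- Intercept `AF = 7240007/2361960 ≈ 3.0653` of the supporting line `AF - BF·v` of `v ↦ v·kF(v)`
on `(0, 3/2]` (chosen so that the line meets `v·kF(v)` exactly at the rational junction `v = 3/2`).
[folklore] -/
def AF : ℝ := 7240007 / 2361960

/-- Slope `BF = 37/20` of the supporting line `AF - BF·v`. [folklore] -/
def BF : ℝ := 37 / 20

/-- The radial majorant `thetaF` of the charged minus-energy: `(AF - BF v)/v` on `(0, 3/2]`, `kF`
on `(3/2, ∞)` (Yuhjtman's `θ` with the tangent data `(w₀, A, B)` replaced by `(3/2, AF, BF)` and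
`h` by `kF`); `v thetaF(v)` is convex on `(0, ∞)`, i.e. `thetaF(‖x‖)` is subharmonic on `ℝ³ ∖ 0`.
[folklore] -/
def thetaF (v : ℝ) : ℝ := if v ≤ 3 / 2 then AF / v - BF else kF v

/-- The truncated majorant `thetaFcut m = χ_{[m,∞)} thetaF` (used with `m = 16/25`). [folklore] -/
def thetaFcut (m v : ℝ) : ℝ := if m ≤ v then thetaF v else 0

/-- `gamF(v) = v thetaF(v)`: the line `AF - BF v` on `(0, 3/2]`, `v kF(v)` beyond; a convex function.
[folklore] -/
def gamF (v : ℝ) : ℝ := v * thetaF v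

/-- **One-variable facts about the majorant** (registered stub `stub_forceTheta` of line `Sketch`):
midpoint convexity of `gamF`; majorisation `kF ≤ thetaF` on `[1/2, ∞)`; `0 ≤ thetaF` on `(0, ∞)`;
`thetaF ≤ 3` on `[16/25, ∞)`; measurability; the drop threshold `kF ≤ 0` on `[0.684, 4/5]`; and the
mass bound `∫_{16/25}^{R} v² thetaF ≤ 28/25` for every `R ≥ 3/2`. -/
def ForceThetaFacts : Prop :=
  (∀ r s : ℝ, 0 ≤ s → s < r → 2 * gamF r ≤ gamF (r + s) + gamF (r - s)) ∧
  (∀ v : ℝ, 1 / 2 ≤ v → kF v ≤ thetaF v) ∧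
  (∀ v : ℝ, 0 < v → 0 ≤ thetaF v) ∧
  (∀ v : ℝ, 16 / 25 ≤ v → thetaF v ≤ 3) ∧
  Measurable thetaF ∧
  (∀ v : ℝ, 171 / 250 ≤ v → v ≤ 4 / 5 → kF v ≤ 0) ∧
  (∀ R : ℝ, 3 / 2 ≤ R → ∫ v in (16 / 25 : ℝ)..R, v ^ 2 * thetaF v ≤ 28 / 25)

/-- **The near-cut-off inequality (♣) for the charged minus-energy** (registered stub
`stub_forceClubsuit`): for `c ∈ [0.342, 0.35]` and `4/5 ≤ r ≤ 16/25 + c` there is an upper limit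
`U ∈ [16/25, min(r + c, 3/2)]` with `(4/3) c³ · r kF(r) ≤ ∫_{16/25}^{U} (AF - BF v)(c² - (v-r)²) dv`
(so that the average of `thetaFcut (16/25)` over the ball `B(x, c)`, `‖x‖ = r`, still dominates
`kF(r)` although the ball dips below the cut-off).  Proved piecewise in `r` with constant bounds
for `kF`. -/
def ForceClubsuitFacts : Prop :=
  ∀ c r : ℝ, 171 / 500 ≤ c → c ≤ 7 / 20 → 4 / 5 ≤ r → r ≤ 16 / 25 + c →
    ∃ U : ℝ, 16 / 25 ≤ U ∧ U ≤ r + c ∧ U ≤ 3 / 2 ∧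
      4 / 3 * c ^ 3 * (r * kF r) ≤
        ∫ v in (16 / 25 : ℝ)..U, (AF - BF * v) * (c ^ 2 - (v - r) ^ 2)

/-- **Capacity of the charged minus-energy** (conclusion of registered stub `stub_forceCapacity`,
which is `ForceThetaFacts → ForceClubsuitFacts → ForceCapacity`): over a finite family of points of
`ℝ³` pairwise `≥ 2c` apart and of norm `≥ 2c`, `c ∈ [0.342, 0.35]`,
`∑ kF(‖z_i‖) ≤ 3 · (28/25) / c³ = (84/25)/c³`. -/
def ForceCapacity : Prop :=
  ∀ (N : ℕ) (s : Finset (Fin N)) (z : Fin N → EuclideanSpace ℝ (Fin 3)) (c : ℝ),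
    171 / 500 ≤ c → c ≤ 7 / 20 → (∀ i ∈ s, 2 * c ≤ ‖z i‖) →
    (∀ i ∈ s, ∀ j ∈ s, i ≠ j → 2 * c ≤ dist (z i) (z j)) →
      ∑ i ∈ s, kF ‖z i‖ ≤ 84 / 25 / c ^ 3

/-- **The final inequality** (registered stub `stub_forceFinalIneq`): for `a ∈ [0.684, 0.7]`,
`24 · (28/25) / a³ < 1 - h(a) + (1/25) h'(a)` (capacity `<` threshold; at `a = 0.7`:
`78.4 < 99.96`). -/
def ForceFinalIneq : Prop :=
  ∀ a : ℝ, 171 / 250 ≤ a → a ≤ 7 / 10 → 24 * (28 / 25) / a ^ 3 < 1 - hLJ a + 1 / 25 * hLJ' a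

/-! ## The final inequality (the one proof in this file: it discharges stub `stub_forceFinalIneq`) -/

/-- The polynomial form of the final inequality: `(672/25) a¹⁰ < a¹³ - 2a⁷ + a + 12/25 - (12/25) a⁶`
on `[0.684, 0.7]` (positive Bernstein coefficients of the difference on that interval). [folklore] -/
theorem forceFinal_poly {a : ℝ} (ha1 : 171 / 250 ≤ a) (ha2 : a ≤ 7 / 10) :
    672 / 25 * a ^ 10 < a ^ 13 - 2 * a ^ 7 + a + 12 / 25 - 12 / 25 * a ^ 6 := by
  have hu : 0 ≤ a - 171 / 250 := by linarith
  have hw : 0 ≤ 7 / 10 - a := by linarith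
  nlinarith [mul_nonneg (pow_nonneg hu 0) (pow_nonneg hw 13),
      mul_nonneg (pow_nonneg hu 1) (pow_nonneg hw 12),
      mul_nonneg (pow_nonneg hu 2) (pow_nonneg hw 11),
      mul_nonneg (pow_nonneg hu 3) (pow_nonneg hw 10),
      mul_nonneg (pow_nonneg hu 4) (pow_nonneg hw 9),
      mul_nonneg (pow_nonneg hu 5) (pow_nonneg hw 8),
      mul_nonneg (pow_nonneg hu 6) (pow_nonneg hw 7),
      mul_nonneg (pow_nonneg hu 7) (pow_nonneg hw 6),
      mul_nonneg (pow_nonneg hu 8) (pow_nonneg hw 5),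
      mul_nonneg (pow_nonneg hu 9) (pow_nonneg hw 4),
      mul_nonneg (pow_nonneg hu 10) (pow_nonneg hw 3),
      mul_nonneg (pow_nonneg hu 11) (pow_nonneg hw 2),
      mul_nonneg (pow_nonneg hu 12) (pow_nonneg hw 1),
      mul_nonneg (pow_nonneg hu 13) (pow_nonneg hw 0)]

/-- **The final inequality** (registered stub `stub_forceFinalIneq` of line `Sketch`, crux
`LjLaminarWindows`): `24 J̄ / a³ < 1 - h(a) + (1/25) h'(a)` on `[0.684, 0.7]`, from `forceFinal_poly`
after clearing the denominator `a¹³`. [folklore] -/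
theorem stub_forceFinalIneq : ForceFinalIneq := by
  intro a ha1 ha2
  have ha : 0 < a := by linarith
  have key := forceFinal_poly ha1 ha2
  have hexp : 1 - hLJ a + 1 / 25 * hLJ' a - 24 * (28 / 25) / a ^ 3 =
      (a ^ 13 - 2 * a ^ 7 + a + 12 / 25 - 12 / 25 * a ^ 6 - 672 / 25 * a ^ 10) / a ^ 13 := by
    unfold hLJ hLJ'
    field_simp
    ring
  have hpos : 0 < (a ^ 13 - 2 * a ^ 7 + a + 12 / 25 - 12 / 25 * a ^ 6 - 672 / 25 * a ^ 10) / a ^ 13 :=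
    div_pos (by linarith) (by positivity)
  linarith

end Summit.AtomisticToContinuum.Crystallization.Theorems.LjLaminarWindowsSketch

end
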